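import Summits.BirchSwinnertonDyer.BirchSwinnertonDyer.Theorems.ErratumRoadFiveEulerHalfGenusSwapDictionary
import Summits.BirchSwinnertonDyer.BirchSwinnertonDyer.Theorems.ErratumRoadFiveEulerHalfGenusFamilyH47OrdersGuard
import Summits.BirchSwinnertonDyer.BirchSwinnertonDyer.Theorems.ErratumRoadFiveEulerHalfGenusClassDataLocal
import Summits.BirchSwinnertonDyer.BirchSwinnertonDyer.Theorems.ErratumRoadFiveNonSurjCornerTamagawaCarriers
import Summits.BirchSwinnertonDyer.BirchSwinnertonDyer.Theorems.ClassRecordThreeEulerHalvesAtThreeKolyvaginFamilyLevelSupply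
import Summits.BirchSwinnertonDyer.BirchSwinnertonDyer.Theorems.ClassRecordThreeEulerHalvesAtThreeKolyvaginFamilyRootClass
import Summits.BirchSwinnertonDyer.BirchSwinnertonDyer.Theorems.ClassRecordThreeEulerHalvesAtThreeKolyvaginFamilyStanding
import Summits.BirchSwinnertonDyer.BirchSwinnertonDyer.Theorems.ClassRecordThreeEulerHalvesAtThreeShimuraWalkEndGlueGross
import Summits.BirchSwinnertonDyer.BirchSwinnertonDyer.Theorems.ClassRecordThreeCornerAtThreeShimuraSwapFamilyCebotarev
import Summits.BirchSwinnertonDyer.BirchSwinnertonDyer.Theorems.ClassRecordThreeCornerAtThreeShimuraFamilyTransverse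
import Summits.BirchSwinnertonDyer.BirchSwinnertonDyer.Theorems.ClassRecordThreeCornerAtThreeShimuraFamilySign
import Summits.BirchSwinnertonDyer.BirchSwinnertonDyer.Theorems.ClassRecordThreeCornerAtThreeShimuraFamilyLabels
import Summits.BirchSwinnertonDyer.BirchSwinnertonDyer.Theorems.ClassRecordThreeCornerAtThreeShimuraWalkSplitCarrier
import Summits.BirchSwinnertonDyer.BirchSwinnertonDyer.Theorems.Rank1ResidualJetCarrierRowData
import Summits.BirchSwinnertonDyer.BirchSwinnertonDyer.Theorems.Rank1ResidualJetKodairaNeronCyclic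
import Summits.BirchSwinnertonDyer.BirchSwinnertonDyer.Theorems.Rank1ResidualJetLocalIndex
import Summits.BirchSwinnertonDyer.BirchSwinnertonDyer.Theorems.Rank1ResidualJetThm63Stringent
import Summits.BirchSwinnertonDyer.BirchSwinnertonDyer.Theorems.Rank1ResidualJetStringentTransport
import Summits.BirchSwinnertonDyer.BirchSwinnertonDyer.Theorems.PoitouTateSelmerStructureDualityConjHolds
import HarnessLib

/-!
# ErratumRoadFive ∕ EulerHalf ∕ genus line — (b2a)+(b2b) IN CELL CR3's PER-LEVEL CURRENCY: Jetchev's per-conductor inequality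
# `ShimuraWalk.LevelSupplyAt … ys (ord_p ∏ c_v)` FOR THE GENUS LABELLED FAMILY, from the frame-generic engine (helper, `--supports 23444`)

Cell bsd-stepL, prover seat `bsd-stepL-imc-p1` g43 (sibling of g42's p734410 `…GenusSwapSupply`).

WHAT.  `ShimuraWalk.genusLevelSupplyAt_of_frameProfile` — on a served genus frame (`FrameProfile W A p q K`: `p ≥ 5` the unique
multiplicative prime of `W`, split multiplicative, split in `K`; `ρ̄_{W,p}` onto) with its labelled family `ys`
(`LabelsAt W (2N_W) …` + the `±` identification `hid` = `GenusLine.GenusLabelsSupplyOddAt`, p729065) and a parametrisation datum `DtW`: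
`ShimuraWalk.LevelSupplyAt hK S.ιc W N_W p ys (ord_p ∏_v c_v(W))` — Jetchev 2008 §6 READ PER CONDUCTOR («`m(c) < k`, `t ≤ k`,
`k + m(c) ≤ M(c)` ⟹ `t ≤ m(c)`», Thm. 6.3 ∘ Prop. 6.4, in cell CR3's universal-divisibility currency `ShimuraWalk.mdiv` and Gross depth
`ShimuraWalk.frobLevelIndex`).  It is tam3-p1's frame-GENERIC (P2) engine `Koly.familyLevelSupply_of_memberships` (ANY odd `p`; it runs the
HALF-core-vertex walk [J] Prop. 6.4 = `JET.Section6.exists_halfCoreVertex` AND the class-level Thm. 6.3 internally) through corner3-p2's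
Gross-currency glue `ShimuraWalk.levelSupplyAt_of_familyLevelSupplyGross`, with EVERY engine input DISCHARGED on the genus frame by tree
theorems: CARRIER = the split place `v₀ ∣ p` moved by `τ` with the (δ) data of `JET.stringentFamily` there (verbatim the carrier block of
the line owner's (b2b) proof `GenusLine.genusJetchevThm63_of_classDataSupply`: `exists_split_place_of_ncard_eq_two`, `JET.carrierRowData_of_split`,
`JET.kodairaNeron_isAddCyclic_forall`, `CornerLocal.padicValNat_tamagawaNumberAt_eq_of_unique_split` — `t = ord_p c_p(W) = ord_p ∏ c_v`);
hCeb = `Koly.exists_grossKolyvaginPrime_addOrderOf_localization_eq_shift` (ρ̄ onto, every level; UNCONDITIONAL); hA ∕ hP ∕ hSel = g42's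
per-datum dictionary (p734084); hsign (POINT form, Gross 5.4 (1)) = `ShimuraWalk.pointsMap_derivedPoint_familyData_of_labels` on the tower
through the datum; hAτ = `KolyvaginFamilyData.pointsMap_mem_pointsSubgroup_family`; hKum = `Koly.familyRootKummer_of_selmerLocalKer`;
htr = `ShimuraWalk.rootClass_familyData_mem_transverseKer` (`d_K < −4`); hstr ([J] Prop. 4.9♯ at `v ∣ p`) = the line owner's
`GenusLine.localization_kolyvaginClass_mem_stringentFamily_of_frameProfile` (p731685) per datum (`stringent_datum_of_frameProfile` below);
h47 = g42's McCallum-4.4 producer at the label guard `2N_W` (p729517); hPT = the tree's PROVED Poitou–Tate duality for Selmer structures.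

WHY (plan `HOME/imc-p1/g42/B2BK-ASSEMBLY-PLAN-imc-p1-g42.md` §§9–11 + the owner's D3 question, bsd-stepL STATUS 2026-08-29 17:20:36Z):
the registered research stub (b2a) `GenusLine.GenusJetchev53` asks for FULL core vertices (`Jetchev2008.IsGlobalCoreVertex`), which is
MORE than [J] Thm. 6.3 consumes (only `𝓗^{−ε}_{𝓕(c)} = 0`); in the per-level currency (b2a)+(b2b) together ARE this theorem, with no
reading binder left.  With g42's `genusSwapSupplyAt_of_frameProfile` (p734410, McCallum 5.2) the two inputs `hswap` ∕ `hlev` of CR3's end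
glue `JET.Section6.depth_le_mdiv_of_swap_of_perLevel` are now BOTH theorems for the genus family.

HONEST FRAMING: conditional on the printed fact (G1) (binder `hG1` and `hid`'s provenance) and on `DtW`; no crux, no stub and no ER5 item
is closed by this file; BSD is proved for no curve.  [cite: Jetchev2008, Thm. 1.4 (p. 812), §6 Thm. 6.3, Prop. 6.4, Lemma 6.1 (pp. 822–825),
Prop. 4.7, Prop. 4.9] [cite: McCallumLMS1991, §3 Cor. 3.2, §4 Prop. 4.4] [cite: GrossLMS1991, §3 (3.1)–(3.3), Prop. 5.4, §6 Prop. 6.2 (1)]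
[cite: Howard2004HeegnerKolyvagin, Prop. 2.1.9] [cite: SilvermanATAEC1994, Cor. IV.9.2 (d)] presearch: in-tree only (composition of tree
theorems); `lean search 'genusLevelSupplyAt'` → none.
-/

set_option autoImplicit false
-- D-0017: single-problem summit, so `Summit.BirchSwinnertonDyer.BirchSwinnertonDyer.…` repeats a namespace BY DESIGN.
set_option linter.dupNamespace false

noncomputable section

open scoped Classical NumberField Pointwise

namespace Summit.BirchSwinnertonDyer.BirchSwinnertonDyer.Theorems.ShimuraWalk

open WeierstrassCurve IsDedekindDomain NumberField Field Function Rat.HeightOneSpectrum Literature.NumberTheory.EllipticCurves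
  Literature.NumberTheory.EllipticCurves.ModularForms Literature.NumberTheory.EllipticCurves.Jetchev2008
  Literature.NumberTheory.EllipticCurves.KolyvaginCocycle
  Literature.NumberTheory.EllipticCurves.Rank1Residual Literature.NumberTheory.GaloisRepresentations
  Literature.NumberTheory.GaloisRepresentations.DiscreteGaloisModule
  Literature.NumberTheory.GaloisCohomology Literature.NumberTheory.Automorphic
  Summit.BirchSwinnertonDyer.Rank1Residual
  Summit.BirchSwinnertonDyer.Rank1Residual.JET Summit.BirchSwinnertonDyer.Rank1Residual.JET.SelmerVocabulary
  Summit.BirchSwinnertonDyer.Rank1Residual.JET.Walk Summit.BirchSwinnertonDyer.Rank1Residual.JET.GlobalDuality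
  Summit.BirchSwinnertonDyer.Rank1Residual.X11b Summit.BirchSwinnertonDyer.Rank1Residual.X11b.Three
  Summit.BirchSwinnertonDyer.BirchSwinnertonDyer.Theorems
  Summit.BirchSwinnertonDyer.BirchSwinnertonDyer.Theorems.GenusLine

/-- An imaginary quadratic field has a `ℚ`-automorphism `≠ 1` (`|Aut(K/ℚ)| = [K : ℚ] = 2`). [folklore] -/
private theorem exists_algEquiv_ne_one_genusLevel (K : Type) [Field K] [NumberField K] (hK : IsImaginaryQuadratic K) :
    ∃ c : K ≃ₐ[ℚ] K, c ≠ 1 := by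
  haveI : Algebra.IsQuadraticExtension ℚ K := ⟨hK.1⟩
  have hcard : Nat.card (K ≃ₐ[ℚ] K) = 2 := by rw [IsGalois.card_aut_eq_finrank, hK.1]
  haveI : Finite (K ≃ₐ[ℚ] K) := Nat.finite_of_card_ne_zero (by rw [hcard]; decide)
  haveI : Nontrivial (K ≃ₐ[ℚ] K) := Finite.one_lt_card_iff_nontrivial.mp (by rw [hcard]; decide)
  exact exists_ne 1

/-- **hstr per datum** (Jetchev Prop. 4.9♯ at the places over `p`): on a served genus frame, the class `c_k(dm)` of ANY datum `dm` on the
labelled family at a square-free Gross–Kolyvagin level `m` of depth `k ≥ 1` localises into `JET.stringentFamily` at every `v ∣ p` — the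
line owner's tower theorem `GenusLine.localization_kolyvaginClass_mem_stringentFamily_of_frameProfile` (p731685) read datum by datum through
g42's tower device `GenusLine.exists_tower_through_datum`. [cite: Jetchev2008, Prop. 4.9, Cor. 4.8] [cite: GrossZagier1986, III (3.1)] -/
theorem stringent_datum_of_frameProfile
    (hG1 : ∀ (N : ℕ) [NeZero N] (W : WeierstrassCurve ℚ) (K : Type) [Field K] [NumberField K],
      phi_heegnerPointOfConductor_mem_range_map_ringClassField_birch N W K)
    {W A : WeierstrassCurve ℚ} [W.IsElliptic] [W.IsGloballyMinimal] [A.IsElliptic] [A.IsGloballyMinimal]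
    {p q : ℕ} [Fact p.Prime] [Fact q.Prime] {K : Type} [Field K] [NumberField K] [NeZero (W.conductorNorm ℤ)]
    (S : GenusHeegnerSettingRC W A p q K) (hprof : FrameProfile W A p q K)
    (DtW : ModularParametrizationData W (W.conductorNorm ℤ)) [∀ j : ℕ, NumberField (ringClassField K S.ιc j)]
    {yK : (W.baseChange K).toAffine.Point}
    {ys : (m : ℕ) → (W.baseChange (ringClassField K S.ιc m)).toAffine.Point} {ε₀ : ℤ}
    (hL : LabelsAt W (2 * W.conductorNorm ℤ) K S.ιc yK ys ε₀)
    (hid : haveI := S.nz; haveI := S.nf; ∀ (c : ℕ), c ≠ 0 → c.Coprime (S.E'.conductorNorm ℤ) →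
      ∀ δ : GenusKolyvaginDatum S.E' K S.ιc S.Dt S.β S.d₁ c,
        genusTransport W S.E' S.D S.C₂ S.hWd K S.ιc δ = ys c ∨ genusTransport W S.E' S.D S.C₂ S.hWd K S.ιc δ = -ys c)
    {k m : ℕ} (hk : 1 ≤ k) (hN : ((p ^ k : ℕ) : ℤ) ≠ 0) (hm : Squarefree m)
    (hKol : ∀ q' ∈ m.primeFactors, IsKolyvaginPrime (W.conductorNorm ℤ) W K p q' ∧ FrobEqFrobInfty W K (p ^ k) q')
    (dm : KolyvaginFamilyData W K S.ιc m) (hdy : dm.y = ys m)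
    (v : HeightOneSpectrum (𝓞 K)) (hpv : ((p : ℕ) : 𝓞 K) ∈ v.asIdeal) :
    galoisCohomology.localization ((W.baseChange K).torsionGaloisModule ((p ^ k : ℕ) : ℤ)) (Sum.inr v) 1
        (dm.kolyvaginClass (Fact.out : p.Prime) k) ∈ JET.stringentFamily W K hN (Sum.inr v) := by
  have hp : p.Prime := Fact.out
  have hK : IsImaginaryQuadratic K := hprof.quad
  have hguard := guard_two_mul_level_of_frameProfile_gross hprof fun q' hq' ↦ (hKol q' hq').1
  obtain ⟨d, hdy', hdm⟩ := exists_tower_through_datum hK S.ιc hm (fun q' hq' ↦ (hguard q' hq').2) ys dm hdy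
  obtain ⟨hB4d, -, -⟩ := familyLabels_of_labelsAt (W := W) hm hguard ys hL d hdy'
  have hA : ∀ (m' : ℕ) (hm' : m' ∣ m) (M' : ℕ),
      IsAdmissible (absoluteGaloisGroup K) (d m' hm').pointsSubgroup ((p ^ M' : ℕ) : ℤ) :=
    fun m' hm' M' ↦ isAdmissible_datum_of_frameProfile S hprof (ne_zero_of_dvd_ne_zero hm.ne_zero hm') (d m' hm') M'
  -- Zhang currency for the line owner's theorem
  have hKolZ : ∀ q' ∈ m.primeFactors, Zhang2014.IsKolyvaginPrime (W.conductorNorm ℤ) W K p q' :=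
    fun q' hq' ↦ (Koly.zhang_isKolyvaginPrime_of_frobEqFrobInfty (W := W) (K := K) hp hk (hKol q' hq').1 (hKol q' hq').2).1
  have hkn : (k : ℕ∞) ≤ Zhang2014.levelIndex W p m := Zhang2014.natCast_le_levelIndex_iff.mpr fun q' hq' ↦
    (Koly.zhang_isKolyvaginPrime_of_frobEqFrobInfty (W := W) (K := K) hp hk (hKol q' hq').1 (hKol q' hq').2).2
  have h := localization_kolyvaginClass_mem_stringentFamily_of_frameProfile W A p q K S hprof hG1 DtW hid hk hN hm hKolZ hkn d hdy'
    hB4d hA dvd_rfl v hpv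
  rwa [hdm] at h

-- many ∀-closed producer goals: binder elaboration exceeds the default
set_option maxHeartbeats 800000 in
/-- **Jetchev's per-conductor inequality (Thm. 6.3 ∘ Prop. 6.4) for the genus labelled family**, `LevelSupplyAt … ys (ord_p ∏ c_v(W))` — see
the module docstring for the dictionary. [cite: Jetchev2008, Thm. 1.4, §6 Thm. 6.3, Prop. 6.4, Lemma 6.1] [cite: McCallumLMS1991, §4 Prop. 4.4]
[cite: GrossLMS1991, Prop. 5.4, §6 Prop. 6.2 (1)] [cite: SilvermanATAEC1994, Cor. IV.9.2 (d)] -/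
theorem genusLevelSupplyAt_of_frameProfile
    (hG1 : ∀ (N : ℕ) [NeZero N] (W : WeierstrassCurve ℚ) (K : Type) [Field K] [NumberField K],
      phi_heegnerPointOfConductor_mem_range_map_ringClassField_birch N W K)
    {W A : WeierstrassCurve ℚ} [W.IsElliptic] [W.IsGloballyMinimal] [A.IsElliptic] [A.IsGloballyMinimal]
    {p q : ℕ} [Fact p.Prime] [Fact q.Prime] {K : Type} [Field K] [NumberField K] [NeZero (W.conductorNorm ℤ)]
    (S : GenusHeegnerSettingRC W A p q K) (hprof : FrameProfile W A p q K)
    (DtW : ModularParametrizationData W (W.conductorNorm ℤ))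
    {yK : (W.baseChange K).toAffine.Point}
    {ys : (m : ℕ) → (W.baseChange (ringClassField K S.ιc m)).toAffine.Point} {ε₀ : ℤ}
    (hL : LabelsAt W (2 * W.conductorNorm ℤ) K S.ιc yK ys ε₀)
    (hid : haveI := S.nz; haveI := S.nf; ∀ (c : ℕ), c ≠ 0 → c.Coprime (S.E'.conductorNorm ℤ) →
      ∀ δ : GenusKolyvaginDatum S.E' K S.ιc S.Dt S.β S.d₁ c,
        genusTransport W S.E' S.D S.C₂ S.hWd K S.ιc δ = ys c ∨ genusTransport W S.E' S.D S.C₂ S.hWd K S.ιc δ = -ys c) :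
    LevelSupplyAt hprof.quad S.ιc W (W.conductorNorm ℤ) p ys (padicValNat p W.tamagawaProduct) := by
  have hK : IsImaginaryQuadratic K := hprof.quad
  have hp : p.Prime := Fact.out
  have hp5 : 5 ≤ p := hprof.five_le
  have hp2 : p ≠ 2 := by omega
  have hD : NumberField.discr K < -4 := GenusKolyvaginRC.discr_lt_neg_four_of_genus hK S.hd₁ S.hd₂ S.hd
  haveI : ∀ j : ℕ, NumberField (ringClassField K S.ιc j) := numberField_ringClassField K hK S.ιc
  have hPT : ∀ (K : Type) [Field K] [NumberField K], poitouTate_selmerStructure_duality_conj K :=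
    fun K _ _ ↦ InputsPoitouTateSelmer.poitouTate_selmerStructure_duality_conj_holds K
  -- ### the trivial case `t = 0`
  by_cases ht0 : padicValNat p W.tamagawaProduct = 0
  · rw [ht0]
    intro k c _ _ _
    exact bot_le
  set t : ℕ := padicValNat p W.tamagawaProduct with ht_def
  -- ### complex conjugation
  obtain ⟨τ, hτ⟩ := exists_algEquiv_ne_one_genusLevel K hK
  -- ### the carrier: the place of `ℚ` at `p` is the UNIQUE split multiplicative place (`only`, `splitp`): `t = ord_p c_p(W)`
  have hbridge : ∀ (v : HeightOneSpectrum (𝓞 ℚ)) (r : ℕ) [Fact r.Prime], (primesEquiv v : ℕ) = r →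
      W.HasSplitMultiplicativeReductionAtPrime r → W.HasSplitMultiplicativeReductionAt v := by
    intro v r _ hv h
    subst hv
    exact (WeierstrassCurve.hasSplitMultiplicativeReductionAtPrime_iff_hasSplitMultiplicativeReductionAt W v).mp h
  set vℚ : HeightOneSpectrum (𝓞 ℚ) := (primesEquiv (R := 𝓞 ℚ)).symm ⟨p, hp⟩ with hvℚ_def
  have hvℚ : (primesEquiv vℚ : ℕ) = p := by rw [hvℚ_def, Equiv.apply_symm_apply]
  have hsℚ : W.HasSplitMultiplicativeReductionAt vℚ := hbridge vℚ p hvℚ hprof.splitp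
  have huniq : ∀ v, W.HasSplitMultiplicativeReductionAt v → v = vℚ := by
    intro v hv
    haveI : Fact (primesEquiv v : ℕ).Prime := ⟨(primesEquiv v).2⟩
    have hmv : W.HasMultiplicativeReductionAtPrime (primesEquiv v : ℕ) :=
      (WeierstrassCurve.hasMultiplicativeReductionAtPrime_primesEquiv_iff_holds W v (primesEquiv v : ℕ) rfl).mpr
        hv.hasMultiplicativeReductionAt
    have hvp : (primesEquiv v : ℕ) = p := hprof.only _ hmv
    apply (primesEquiv (R := 𝓞 ℚ)).injective
    rw [hvℚ_def, Equiv.apply_symm_apply]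
    exact Subtype.ext hvp
  have ht : t = padicValNat p ((W.baseChange ℚ_[p]).localTamagawaNumber ℤ_[p]) := by
    rw [ht_def, ← CornerLocal.padicValNat_tamagawaNumberAt_eq_of_unique_split W p hp5 hsℚ huniq,
      WeierstrassCurve.tamagawaNumberAt_def, WeierstrassCurve.localTamagawaNumber_padic_eq_holds W vℚ p hvℚ]
  -- the split carrier place `v₀ ∣ p` of `K` (`sp` at `p ∣ N`, `p ≠ q`) and the transport of the row data
  have hmult : W.HasMultiplicativeReductionAtPrime p := hprof.splitp.hasMultiplicativeReductionAtPrime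
  have hpN : p ∣ W.conductorNorm ℤ :=
    (W.dvd_conductorNorm_iff_not_hasGoodReductionAtPrime p).mpr
      (WeierstrassCurve.HasMultiplicativeReduction.not_hasGoodReduction (R := ℤ_[p]) hmult)
  obtain ⟨v₀, hv₀, hv₀N, hpv₀⟩ := exists_split_place_of_ncard_eq_two K hK τ hτ p
    (hprof.sp p hp hpN (fun h ↦ hprof.q_ne h.symm)) hpN
  obtain ⟨hminK, hminP, hcEq, hc0, hcyc⟩ := JET.carrierRowData_of_split W K p hK τ v₀ hv₀ hpv₀
  haveI := hminK
  haveI := hminP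
  have hdvd : p ∣ (W.baseChange ℚ_[p]).localTamagawaNumber ℤ_[p] := by
    have h1 : 1 ≤ padicValNat p ((W.baseChange ℚ_[p]).localTamagawaNumber ℤ_[p]) := by
      rw [← ht]; exact Nat.one_le_iff_ne_zero.mpr ht0
    exact dvd_of_one_le_padicValNat h1
  haveI := hcyc (JET.kodairaNeron_isAddCyclic_forall W p p hp2 hdvd)
  have hfac : (((W.baseChange K).baseChange (v₀.adicCompletion K)).localTamagawaNumber
      (v₀.adicCompletionIntegers K)).factorization p = t := by
    rw [hcEq, Nat.factorization_def _ hp, ht]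
  -- `p` and `N_W` lie in both carrier places
  have hτp : τ • ((p : ℕ) : 𝓞 K) = (p : 𝓞 K) := by
    rw [← MulSemiringAction.toRingHom_apply, map_natCast]
  have hpτv₀ : ((p : ℕ) : 𝓞 K) ∈ (τ • v₀).asIdeal := by
    have := (HeightOneSpectrum.smul_mem_smul_asIdeal_iff τ v₀ ((p : ℕ) : 𝓞 K)).mpr hpv₀
    rwa [hτp] at this
  have hv₀N' : ((W.conductorNorm ℤ : ℕ) : 𝓞 K) ∈ (τ • v₀).asIdeal := by
    have := (HeightOneSpectrum.smul_mem_smul_asIdeal_iff τ v₀ ((W.conductorNorm ℤ : ℕ) : 𝓞 K)).mpr hv₀N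
    have hτN : τ • ((W.conductorNorm ℤ : ℕ) : 𝓞 K) = ((W.conductorNorm ℤ : ℕ) : 𝓞 K) := by
      rw [← MulSemiringAction.toRingHom_apply, map_natCast]
    rwa [hτN] at this
  -- ### the per-datum producers in cell CR3's shapes (g42's dictionary p734084)
  have hA : ∀ (n : ℕ) (d : KolyvaginFamilyData W K S.ιc n), d.y = ys n → Squarefree n →
      (∀ q' ∈ n.primeFactors, IsKolyvaginPrime (W.conductorNorm ℤ) W K p q') →
      ∀ j : ℕ, IsAdmissible (absoluteGaloisGroup K) d.pointsSubgroup ((p ^ j : ℕ) : ℤ) :=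
    fun n d _ hn _ j ↦ isAdmissible_datum_of_frameProfile S hprof hn.ne_zero d j
  have hidx : ∀ {n : ℕ} (j : ℕ), (∀ q' ∈ n.primeFactors, IsKolyvaginPrime (W.conductorNorm ℤ) W K p q' ∧
      FrobEqFrobInfty W K (p ^ j) q') → ((j : ℕ) : ℕ∞) ≤ frobLevelIndex W K p n :=
    fun j hKol ↦ (natCast_le_frobLevelIndex_iff (fun q' hq' ↦ (hKol q' hq').1) j).mpr fun q' hq' ↦ (hKol q' hq').2
  have hP : ∀ (n : ℕ) (d : KolyvaginFamilyData W K S.ιc n), d.y = ys n → Squarefree n →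
      (∀ q' ∈ n.primeFactors, IsKolyvaginPrime (W.conductorNorm ℤ) W K p q') →
      ∀ j : ℕ, 1 ≤ j → (j : ℕ∞) ≤ frobLevelIndex W K p n →
        d.toGeomPoints d.derivedPoint ∈ invPoints (absoluteGaloisGroup K) d.pointsSubgroup ((p ^ j : ℕ) : ℤ) :=
    fun n d hdy hn hKP j hj hjM ↦ invPoints_datum_of_frameProfile S hprof DtW hL hj hn
      (fun q' hq' ↦ ⟨hKP q' hq', (natCast_le_frobLevelIndex_iff hKP j).mp hjM q' hq'⟩) d hdy
  have hSel : ∀ (M n : ℕ) (d : KolyvaginFamilyData W K S.ιc n), 1 ≤ M → d.y = ys n → Squarefree n →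
      (∀ q' ∈ n.primeFactors, IsKolyvaginPrime (W.conductorNorm ℤ) W K p q' ∧ FrobEqFrobInfty W K (p ^ M) q') →
      ∀ 𝔳 : HeightOneSpectrum (𝓞 K), (n : 𝓞 K) ∉ 𝔳.asIdeal →
        d.kolyvaginClass (Fact.out : p.Prime) M ∈ selmerLocalKer (W.baseChange K) (𝔳.adicCompletion K) ((p ^ M : ℕ) : ℤ) :=
    fun M n d hM hdy hn hKol 𝔳 h𝔳 ↦ selmerLocalKer_datum_of_frameProfile hG1 S hprof DtW hL hid hM hn hKol d hdy 𝔳 h𝔳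
  -- ### the END GLUE (Gross currency) over the (P2) engine
  refine levelSupplyAt_of_familyLevelSupplyGross hK S.ιc DtW hp ys t ?_ ?_
  · -- `hB4` read off (B4) of `LabelsAt` at the guard `2N_W`
    intro k hk hKP ℓ hℓ σ hσ
    have hle : ringClassField K S.ιc (k / ℓ) ≤ ringClassField K S.ιc k :=
      ringClassField_mono hK S.ιc (Nat.div_dvd_of_dvd (Nat.dvd_of_mem_primeFactors hℓ)) hk.ne_zero
    exact ⟨_, hL.2.2.2.2.1 k hk (guard_two_mul_level_of_frameProfile_gross hprof hKP) ℓ hℓ hle σ hσ⟩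
  refine Koly.familyLevelSupply_of_memberships W K hK hD S.ιc p hp2 τ hτ hPT ys ε₀ hL.1 t v₀ hv₀ hv₀N hv₀N'
    ?_ ?_ hA hP ?_ ?_ ?_ ?_ ?_ ?_
  · -- the carrier's (δ) data at every level `p^k ≥ p^t`
    intro _ k hn htk
    refine ⟨fun w ↦ JET.stringentFamily_le_kummer W K hn w,
      fun v' w h _ x hx ↦ JET.conjActPlace_mem_stringentFamily W τ hn h hx,
      JET.isAddCyclic_kummer_quotient_stringentFamily W K hn v₀, ?_⟩
    rw [← hfac]
    exact JET.relIndex_stringentFamily_eq_pow W K hp k hn v₀ hc0 (by rw [hfac]; exact htk)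
  · -- Čebotarev at every level `p^k` (ρ̄ onto; Jetchev Lemma 6.1 = McCallum Cor. 3.2 with the Frobenius class kept)
    intro k hk j e he x y hx hy hy0 b
    obtain ⟨ℓ, hbℓ, ⟨hKol, hfrob⟩, hord⟩ :=
      Koly.exists_grossKolyvaginPrime_addOrderOf_localization_eq_shift W (N := W.conductorNorm ℤ) hK hp2 hprof.surj
        τ hτ hk j he x y hx hy hy0 b
    exact ⟨ℓ, hbℓ, hKol, hfrob, hord⟩
  · -- `τ̃`-stability of `E(K[n]) ⊆ E(K̄)`
    intro n d _ hn
    exact d.pointsMap_mem_pointsSubgroup_family hK hn.ne_zero (isLiftOfAut_liftAut τ)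
  · -- `hsign` (POINT form, Gross 5.4 (1)) on the tower through the datum
    intro n d hdy hn hKP j hj hjM
    have hfrob : ∀ q' ∈ n.primeFactors, FrobEqFrobInfty W K (p ^ j) q' := (natCast_le_frobLevelIndex_iff hKP j).mp hjM
    have hguard := guard_two_mul_level_of_frameProfile_gross hprof hKP
    obtain ⟨D, hDy, hDd⟩ := exists_tower_through_datum hK S.ιc hn (fun q' hq' ↦ (hguard q' hq').2) ys d hdy
    obtain ⟨hB4d, -, hB3d⟩ := familyLabels_of_labelsAt (W := W) hn hguard ys hL D hDy
    have hA' : ∀ (m : ℕ) (hm : m ∣ n), IsAdmissible (absoluteGaloisGroup K) (D m hm).pointsSubgroup ((p ^ j : ℕ) : ℤ) :=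
      fun m hm ↦ isAdmissible_datum_of_frameProfile S hprof (ne_zero_of_dvd_ne_zero hn.ne_zero hm) (D m hm) j
    have h := pointsMap_derivedPoint_familyData_of_labels hK S.ιc hp hj DtW hn
      (fun q' hq' ↦ ⟨hKP q' hq', hfrob q' hq'⟩) D hτ (isLiftOfAut_liftAut τ) ε₀ hB4d hB3d hA' n dvd_rfl
    rwa [hDd] at h
  · -- Kummer membership of the root classes off `n`
    exact Koly.familyRootKummer_of_selmerLocalKer W hK S.ιc p ys hA hP hSel
  · -- transverse condition of the root classes at the primes of `n` (`d_K < −4`)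
    intro k n d _ _ hn hG u Q hAk hQ hQP huk ℓ hℓ
    exact rootClass_familyData_mem_transverseKer W hK hD hp2 S.ιc k hn (fun q' hq' ↦ (hG q' hq').1) d u Q hAk hQ hQP huk hℓ
  · -- stringent membership at the two carrier places (both lie over `p`): Jetchev 4.9♯ for the genus family
    intro k hn' n d hk hdy hn hG _ q₀ hq₀
    have hq₀p : ((p : ℕ) : 𝓞 K) ∈ q₀.asIdeal := by
      simp only [Finset.mem_insert, Finset.mem_singleton] at hq₀
      rcases hq₀ with rfl | rfl
      exacts [hpv₀, hpτv₀]
    exact stringent_datum_of_frameProfile hG1 S hprof DtW hL hid hk hn' hn hG d hdy q₀ hq₀p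
  · -- `h47`: McCallum Prop. 4.4 for any two presentations, at the label guard `2N_W`
    intro k n n' d d' ℓ hk hdy hd'y hn hKol' hℓ hℓn hn' v hv
    exact addOrderOf_localization_kolyvaginClass_familyData_eq_of_labelsGuard_of_admissible hK hD S.ιc rfl hp2 DtW ys hL hA
      k n n' d d' ℓ hk hdy hd'y hn hKol' hℓ hℓn hn'
      (fun q' hq' ↦ (guard_two_mul_level_of_frameProfile_gross hprof (fun r hr ↦ (hKol' r hr).1) q' hq').1) v hv

end Summit.BirchSwinnertonDyer.BirchSwinnertonDyer.Theorems.ShimuraWalk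

end
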